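import Literature.Barriers.NavierStokesRegularity.NavierStokesInequalityCantorProfileField
import Literature.Barriers.NavierStokesRegularity.NavierStokesInequalityStructureTranslate
import HarnessLib

/-!
# The translated pairs of structures of Ożański's §6.3 Step 1 and their Lemma-4.1 data

Barrier catalogue support file for `NavierStokesRegularity` (D-0021), on the discharge path of
fact D′ `Literature.Barriers.NavierStokesRegularity.NSICantorBlock_of_arrangement`
(`NavierStokesInequalityCantorArrangement`; W. S. Ożański, arXiv:1709.00602v4, §6.3 Step 1:
"We renumber the functions `h_i(π_m⁻¹(τʲx₁), x₂, t)`. … let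
`h_i^𝔪(x₁,x₂,t) := h_i(π_m⁻¹(τʲx₁), x₂, t)`, `f_i^𝔪`, `v_i^𝔪`, `φ_i^𝔪`, `U_i^𝔪 := {(x₁,x₂) :
(π_m⁻¹(τʲx₁), x₂) ∈ U_i}` … Then `(v_i^𝔪, f_i^𝔪, φ_i^𝔪)` and `(v_i^𝔪, h^𝔪_{i,t}, φ_i^𝔪)` are structures on
`U_i^𝔪` … and the sets `K^𝔪 = Ū_1^𝔪 ∪ Ū_2^𝔪` are pairwise disjoint translates of `Ū₁ ∪ Ū₂` in the
`x₁` direction" (6.22); Scheffer 1987, (5.26)–(5.33): the configurations `Z`). Given a pair of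
structures with the data of Lemma 4.1 (the tree's `IsQData` for the `Fin 2`-indexed base
families) and finitely many axial positions `c : A → ℝ` whose translates of `G = R(Ū₁ ∪ Ū₂)` are
pairwise disjoint, this file builds the translated families

  `U_i^m = {q : q - (0, c m) ∈ U_i}`, `g_i^m(q) = g_i(q - (0, c m))` (`levelSet`, `levelFun`,
  `levelFunT` through `axialShift`)

and PROVES: they form a family of structures with pairwise disjoint closures
(`isNSIStructureFamily_level`), they carry the input of §6.3 Steps 2–3
(`IsQData.isCantorQData_level`: every clause of `IsCantorQData`, the perturbation criteria and the
squares (6.10)–(6.11) being covariant under axial translations — `IsNSIStructure.comp_add_axial`,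
`pressureInteraction_comp_add_axial`), and the bookkeeping used by Proposition 16 (ii), (iv):
`R(Ū_i^m)` is the translate of `R(Ū_i)` (same volume), a point of one translate of `Ū₁ ∪ Ū₂` lies
in no other, and `H_i^m(0) = f_i^m`.

## References

* W. S. Ożański, *On weak solutions to the Navier–Stokes inequality with internal
  singularities*, arXiv:1709.00602v4, §6.3 Step 1 ((6.22)) and Step 2. [`Ozanski2017NSISingular`]
* V. Scheffer, *Nearly one dimensional singularities of solutions to the Navier–Stokes
  inequality*, Comm. Math. Phys. 110 (1987), Lemma 5.5 with (5.26)–(5.33). [`Scheffer1987`]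
-/

noncomputable section

open MeasureTheory Set Function Filter Topology TopologicalSpace Metric
open scoped ENNReal InnerProductSpace RealInnerProductSpace ContDiff

namespace Literature.Barriers.NavierStokesRegularity

open Literature.Analysis.FluidPDE

variable {A : Type*} [Fintype A]

/-! ### Axial shifts and the translated families -/

/-- The planar shift `q ↦ q - (0, c)` reading off, at a point of the copy at axial position `c`,
the corresponding point of the base pair (Ożański §6.3 Step 1: `(π_m⁻¹(τʲx₁), x₂)`).
[cite: Ozanski2017NSISingular, §6.3 Step 1] -/
def axialShift (c : ℝ) (q : ℝ × ℝ) : ℝ × ℝ :=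
  q + (0, -c)

omit [Fintype A] in
/-- Unfolding `axialShift`. [folklore] -/
@[simp] theorem axialShift_apply (c : ℝ) (q : ℝ × ℝ) : axialShift c q = q + (0, -c) := rfl

/-- **The translated sets** `U_i^m = {q : q - (0, c m) ∈ U_i}`. [cite: Ozanski2017NSISingular, §6.3 Step 1] -/
def levelSet (K : Fin 2 → Set (ℝ × ℝ)) (c : A → ℝ) : Fin 2 → A → Set (ℝ × ℝ) :=
  fun i m => axialShift (c m) ⁻¹' K i

/-- **The translated planar data** `g_i^m(q) = g_i(q - (0, c m))`. [cite: Ozanski2017NSISingular, §6.3 Step 1] -/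
def levelFun {β : Type*} (g : Fin 2 → ℝ × ℝ → β) (c : A → ℝ) : Fin 2 → A → ℝ × ℝ → β :=
  fun i m q => g i (axialShift (c m) q)

/-- **The translated time-dependent profiles** `h_i^m(t)(q) = h_i(t)(q - (0, c m))`.
[cite: Ozanski2017NSISingular, §6.3 Step 1 (6.19)] -/
def levelFunT {β : Type*} (g : Fin 2 → ℝ → ℝ × ℝ → β) (c : A → ℝ) : Fin 2 → A → ℝ → ℝ × ℝ → β :=
  fun i m t q => g i t (axialShift (c m) q)

omit [Fintype A] in
/-- Unfolding `levelSet`. [folklore] -/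
@[simp] theorem mem_levelSet {K : Fin 2 → Set (ℝ × ℝ)} {c : A → ℝ} {i : Fin 2} {m : A} {q : ℝ × ℝ} :
    q ∈ levelSet K c i m ↔ q + (0, -c m) ∈ K i := Iff.rfl

omit [Fintype A] in
/-- Unfolding `levelFun`. [folklore] -/
@[simp] theorem levelFun_apply {β : Type*} (g : Fin 2 → ℝ × ℝ → β) (c : A → ℝ) (i : Fin 2) (m : A)
    (q : ℝ × ℝ) : levelFun g c i m q = g i (q + (0, -c m)) := rfl

omit [Fintype A] in
/-- Unfolding `levelFunT`. [folklore] -/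
@[simp] theorem levelFunT_apply {β : Type*} (g : Fin 2 → ℝ → ℝ × ℝ → β) (c : A → ℝ) (i : Fin 2)
    (m : A) (t : ℝ) (q : ℝ × ℝ) : levelFunT g c i m t q = g i t (q + (0, -c m)) := rfl

omit [Fintype A] in
/-- `levelSet` is the preimage under the shift. [folklore] -/
theorem levelSet_eq (K : Fin 2 → Set (ℝ × ℝ)) (c : A → ℝ) (i : Fin 2) (m : A) :
    levelSet K c i m = (fun q => q + (0, -c m)) ⁻¹' K i := rfl

omit [Fintype A] in
/-- Closures of the translated sets. [folklore] -/
theorem closure_levelSet (K : Fin 2 → Set (ℝ × ℝ)) (c : A → ℝ) (i : Fin 2) (m : A) :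
    closure (levelSet K c i m) = (fun q => q + (0, -c m)) ⁻¹' closure (K i) := by
  rw [levelSet_eq, closure_preimage_add]

omit [Fintype A] in
/-- **`R(Ū_i^m)` is the axial translate of `R(Ū_i)`** ((6.22)). [cite: Ozanski2017NSISingular, §6.3 Step 1 (6.22)] -/
theorem revolve_closure_levelSet (K : Fin 2 → Set (ℝ × ℝ)) (c : A → ℝ) (i : Fin 2) (m : A) :
    revolve (closure (levelSet K c i m)) =
      (fun y : EuclideanSpace ℝ (Fin 3) => y + c m • eZ) '' revolve (closure (K i)) := by
  rw [closure_levelSet, revolve_preimage_add_axial]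
  ext y
  simp only [mem_preimage, mem_image]
  constructor
  · intro hy
    exact ⟨y + (-c m) • eZ, hy, by rw [add_assoc, ← add_smul, neg_add_cancel, zero_smul, add_zero]⟩
  · rintro ⟨y', hy', rfl⟩
    rwa [add_assoc, ← add_smul, add_neg_cancel, zero_smul, add_zero]

omit [Fintype A] in
/-- The volume of `R(Ū_i^m)` is that of `R(Ū_i)`. [folklore] -/
theorem volume_revolve_closure_levelSet (K : Fin 2 → Set (ℝ × ℝ)) (c : A → ℝ) (i : Fin 2) (m : A) :
    volume (revolve (closure (levelSet K c i m))) = volume (revolve (closure (K i))) := by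
  rw [closure_levelSet, revolve_preimage_add_axial]
  exact measure_preimage_add_right volume (-c m • eZ) _

/-! ### Disjointness of the copies -/

omit [Fintype A] in
/-- **A point of a translate of `Ū₁ ∪ Ū₂` lies in no other translate**: if the translates
`R(Ū₁ ∪ Ū₂) + c m x̂_axis` are pairwise disjoint and `Ū₁ ∪ Ū₂ ⊆ P`, then for `q ∈ Ū₁ ∪ Ū₂` and
`m ≠ m'`, `q + (0, c m - c m') ∉ Ū₁ ∪ Ū₂` (Ożański (6.22)). [cite: Ozanski2017NSISingular, §6.3 Step 1 (6.22)] -/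
theorem notMem_of_disjoint_translates {K : Set (ℝ × ℝ)} (hK : K ⊆ halfPlane) {c : A → ℝ}
    (hdisj : ∀ m m' : A, m ≠ m' →
      Disjoint ((fun y : EuclideanSpace ℝ (Fin 3) => y + c m • eZ) '' revolve K)
        ((fun y : EuclideanSpace ℝ (Fin 3) => y + c m' • eZ) '' revolve K))
    {m m' : A} (hne : m ≠ m') {q : ℝ × ℝ} (hq : q ∈ K) : q + (0, c m - c m') ∉ K := by
  intro hq'
  have hq0 : 0 ≤ q.1 := le_of_lt (hK hq)
  -- the point `R(q) + c m x̂` lies in both translates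
  have h1 : meridianPoint q + c m • eZ ∈ (fun y : EuclideanSpace ℝ (Fin 3) => y + c m • eZ) '' revolve K :=
    ⟨meridianPoint q, by rw [mem_revolve, meridian_meridianPoint hq0]; exact hq, rfl⟩
  have h2 : meridianPoint q + c m • eZ ∈ (fun y : EuclideanSpace ℝ (Fin 3) => y + c m' • eZ) '' revolve K := by
    refine ⟨meridianPoint (q + (0, c m - c m')), ?_, ?_⟩
    · rw [mem_revolve, meridian_meridianPoint (by simpa using hq0)]; exact hq'
    · show meridianPoint (q + (0, c m - c m')) + c m' • eZ = meridianPoint q + c m • eZ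
      rw [meridianPoint_add, add_assoc, ← add_smul, sub_add_cancel]
  exact Set.disjoint_left.1 (hdisj m m' hne) h1 h2

omit [Fintype A] in
/-- **The translated structures form a family with pairwise disjoint closures**
(Ożański §6.3 Step 1: the `2𝔐` structures `(v_i^𝔪, f_i^𝔪, φ_i^𝔪)` on `U_i^𝔪`, `Ū_1 ∩ Ū_2 = ∅` and the
`K^𝔪` pairwise disjoint). [cite: Ozanski2017NSISingular, §6.3 Step 1] -/
theorem isNSIStructureFamily_level {U : Fin 2 → Set (ℝ × ℝ)} {V : Fin 2 → ℝ × ℝ → ℝ × ℝ}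
    {f φ : Fin 2 → ℝ × ℝ → ℝ} (hS : ∀ i, IsNSIStructure (U i) (V i) (f i) (φ i))
    (hd : Disjoint (closure (U 0)) (closure (U 1))) {c : A → ℝ}
    (hdisj : ∀ m m' : A, m ≠ m' →
      Disjoint ((fun y : EuclideanSpace ℝ (Fin 3) => y + c m • eZ) '' revolve (closure (U 0) ∪ closure (U 1)))
        ((fun y : EuclideanSpace ℝ (Fin 3) => y + c m' • eZ) '' revolve (closure (U 0) ∪ closure (U 1)))) :
    IsNSIStructureFamily (levelSet U c) (levelFun V c) (levelFun f c) (levelFun φ c) where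
  isNSIStructure i m := (hS i).comp_add_axial (-c m)
  disjoint := by
    rintro ⟨i, m⟩ ⟨i', m'⟩ hne
    rw [closure_levelSet, closure_levelSet, Set.disjoint_left]
    intro q hq hq'
    simp only [mem_preimage] at hq hq'
    have hK : closure (U 0) ∪ closure (U 1) ⊆ halfPlane :=
      union_subset (hS 0).closure_subset (hS 1).closure_subset
    have hmem : ∀ {i : Fin 2} {p : ℝ × ℝ}, p ∈ closure (U i) → p ∈ closure (U 0) ∪ closure (U 1) := by
      intro i p hp
      fin_cases i
      · exact Or.inl hp
      · exact Or.inr hp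
    by_cases hm : m = m'
    · subst hm
      have hii : i ≠ i' := fun h => hne (by rw [h])
      fin_cases i <;> fin_cases i'
      · exact hii rfl
      · exact Set.disjoint_left.1 hd hq hq'
      · exact Set.disjoint_left.1 hd hq' hq
      · exact hii rfl
    · have key := notMem_of_disjoint_translates hK hdisj hm (hmem hq)
      apply key
      have e : q + (0, -c m) + (0, c m - c m') = q + (0, -c m') := by
        ext <;> simp; ring
      rw [e]
      exact hmem hq'

/-! ### Translating the perturbation criterion -/

/-- The damped profile of translated data is the translate of the damped profile. [folklore] -/
theorem dampedProfile_comp_add (f φ : ℝ × ℝ → ℝ) (δ t : ℝ) (c q : ℝ × ℝ) :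
    dampedProfile (fun q' => f (q' + c)) (fun q' => φ (q' + c)) δ t q = dampedProfile f φ δ t (q + c) := by
  rw [dampedProfile_apply, dampedProfile_apply]

/-- **The perturbation criterion is covariant under axial translations.**
[cite: Ozanski2017NSISingular, §6.3 Step 1 and §4 (4.15), (4.20)] -/
theorem DampedCriterion.comp_add_axial {U : Set (ℝ × ℝ)} {v : ℝ × ℝ → ℝ × ℝ} {f φ ψ : ℝ × ℝ → ℝ}
    {δ T : ℝ} (h : DampedCriterion U v f φ ψ δ T) (s : ℝ) :
    DampedCriterion ((fun q => q + (0, s)) ⁻¹' U) (fun q => v (q + (0, s))) (fun q => f (q + (0, s)))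
      (fun q => φ (q + (0, s))) (fun q => ψ (q + (0, s))) δ T := by
  intro t ht g hg hg0 hgd hgv
  -- the pulled-back test profile on the base
  set g' : ℝ × ℝ → ℝ := fun q => g (q + (0, -s)) with hg'
  have e1 : ∀ q : ℝ × ℝ, q + (0, -s) + (0, s) = q := fun q => by ext <;> simp
  have e2 : ∀ q : ℝ × ℝ, q + (0, s) + (0, -s) = q := fun q => by ext <;> simp
  have eg : (fun q => g' (q + (0, s))) = g := by funext q; simp only [hg', e2]
  have hg's : ContDiff ℝ ∞ g' := hg.comp (contDiff_id.add contDiff_const)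
  have hg'0 : ∀ q, 0 ≤ g' q := fun q => hg0 _
  have hg'd : ∀ q, φ q < 1 → g' q = dampedProfile f φ δ t q := fun q hq => by
    have h1 := hgd (q + (0, -s)) (by simpa only [e1] using hq)
    rw [dampedProfile_comp_add, e1] at h1
    exact h1
  have hg'v : ∀ q, φ q = 1 → (v q).1 ^ 2 + (v q).2 ^ 2 < g' q ^ 2 := fun q hq => by
    have h1 := hgv (q + (0, -s)) (by simpa only [e1] using hq)
    simpa only [e1] using h1
  obtain ⟨hstr, hL, hL', hpos, hzero, heq⟩ := h t ht g' hg's hg'0 hg'd hg'v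
  refine ⟨fun b hb => ?_, fun q hq => ?_, fun q hq hq' => ?_, fun q hq => ?_, fun q hq => ?_,
    fun q hq => ?_⟩
  · have h1 := (hstr b hb).comp_add_axial s
    rw [eg] at h1
    exact h1
  · rw [← eg, opL_comp_add_axial]
    exact hL _ hq
  · rw [← eg, opL_comp_add_axial]
    refine hL' _ ?_ hq'
    rw [tsupport_comp_add] at hq
    exact hq
  · rw [← eg]
    exact hpos _ hq
  · rw [← eg]
    refine hzero _ ?_
    rw [closure_preimage_add] at hq
    exact hq
  · rw [← eg]
    refine heq _ ?_
    rw [tsupport_comp_add] at hq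
    exact hq

/-! ### The input of §6.3 Steps 2–3 for the translated pairs -/

namespace IsQData

variable {U : Fin 2 → Set (ℝ × ℝ)} {V : Fin 2 → ℝ × ℝ → ℝ × ℝ} {f φ ψ : Fin 2 → ℝ × ℝ → ℝ}
  {H : Fin 2 → ℝ → ℝ × ℝ → ℝ} {T δ : ℝ} {κ : ℝ → ℝ} {a₀ : ℕ → Fin 2 → ℝ → ℝ}

/-- **The profiles of Lemma 4.1 start at `f`: `H_{i,0} = fᵢ`** (`κ(0) = 0`, the limit integral is
over `[0,0]`, `H ≥ 0`). [cite: Ozanski2017NSISingular, Lemma 4.1 (4.9)] -/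
theorem H_zero (hQ : IsQData U V f φ ψ H T δ κ a₀) (i : Fin 2) (x : ℝ × ℝ) : H i 0 x = f i x := by
  have h0 : κ 0 = 0 := hQ.κ_eq 0 ⟨le_rfl, hQ.T_pos.le⟩
  have h1 := hQ.H_sq i 0 x
  rw [h0] at h1
  have hlim : oscLimit (fFam V H) i 0 x = 0 := by
    by_cases hi : i = 1
    · subst hi; simp [oscLimit]
    · simp [oscLimit, hi]
  rw [hlim] at h1
  have h2 : H i 0 x ^ 2 = f i x ^ 2 := by rw [h1]; ring
  have hH0 : 0 ≤ H i 0 x := (hQ.H_str_one i 0).f_nonneg x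
  have hf0 : 0 ≤ f i x := (hQ.isNSIStructure i).f_nonneg x
  rw [← Real.sqrt_sq hH0, h2, Real.sqrt_sq hf0]

/-- `H_{i,t} = 0` off `Ūᵢ`. [cite: Ozanski2017NSISingular, Lemma 4.1 (4.10)] -/
theorem H_eq_zero (hQ : IsQData U V f φ ψ H T δ κ a₀) (i : Fin 2) (t : ℝ) {x : ℝ × ℝ}
    (hx : x ∉ closure (U i)) : H i t x = 0 :=
  (hQ.H_str_one i t).f_eq_zero hx

/-- **The translated pairs carry the input of §6.3 Steps 2–3** (`IsCantorQData`): every clause is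
the translate of the corresponding clause of Lemma 4.1 for the base pair (`IsQData`), the new
oscillatory processes being any `IsCantorOscFamily` (Theorem 17); in particular the squares
(6.10)–(6.11): `(h^m_{2,t})² = (f_2^m)² - 2tδφ_2^m + ∫₀ᵗ v_2^m·F[v_1^m, h^m_{1,s}] ds` is the translate of
(4.9) by the covariance `F[v(·+c), h(·+c)] = F[v,h](· + c)`.
[cite: Ozanski2017NSISingular, §6.3 Steps 1–2 ((6.19)–(6.20))] -/
theorem isCantorQData_level (hQ : IsQData U V f φ ψ H T δ κ a₀) (c : A → ℝ)
    {a : ℕ → Fin 2 → A → ℝ → ℝ} (ha : IsCantorOscFamily A T a) :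
    IsCantorQData (levelSet U c) (levelFun V c) (levelFun f c) (levelFun φ c) (levelFun ψ c)
      (levelFunT H c) T δ κ a where
  isNSIStructure i m := (hQ.isNSIStructure i).comp_add_axial (-c m)
  δ_pos := hQ.δ_pos
  T_pos := hQ.T_pos
  κ_smooth := hQ.κ_smooth
  κ_eq := hQ.κ_eq
  deriv_κ_eq := hQ.deriv_κ_eq
  κ_mem := hQ.κ_mem
  gap i m := by
    obtain ⟨μ, hμ, hgap⟩ := hQ.gap i
    refine ⟨μ, hμ, fun t ht x hx => ?_⟩
    have e : levelFun φ c i m = fun q => φ i (q + ((0 : ℝ), -c m)) := rfl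
    rw [e, tsupport_comp_add] at hx
    exact hgap t ht _ hx
  crit i m := by
    have h := (hQ.crit i).comp_add_axial (-c m)
    exact h
  H_smooth i m := by
    have hc : ContDiff ℝ ∞ fun p : ℝ × (ℝ × ℝ) => (p.1, p.2 + ((0 : ℝ), -c m)) :=
      contDiff_fst.prodMk (contDiff_snd.add contDiff_const)
    exact (hQ.H_smooth i).comp hc
  H_str i m t b hb := by
    have h := (hQ.H_str i t b hb).comp_add_axial (-c m)
    exact h
  H_sq i m t x := by
    have h1 := hQ.H_sq i t (x + (0, -c m))
    simp only [levelFunT_apply, levelFun_apply]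
    rw [h1]
    congr 1
    -- the limits agree: `coscLimit (cfFam …) i m = oscLimit (fFam …) i ∘ shift`
    by_cases hi : i = 1
    · subst hi
      simp only [oscLimit, coscLimit, if_true]
      congr 1
      refine intervalIntegral.integral_congr fun s _ => ?_
      have hF : pressureInteraction (levelFun V c 0 m) (levelFunT H c 0 m s) x =
          pressureInteraction (V 0) (H 0 s) (x + (0, -c m)) :=
        pressureInteraction_comp_add_axial (V 0) (H 0 s) (-c m) x
      simp only [fFam, cfFam, hF, levelFun_apply]
    · simp only [oscLimit, coscLimit, hi, if_false]
  osc := ha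

end IsQData

/-! ### The profiles at the translated points (Proposition 16 (ii)) -/

/-- **Sums over the copies collapse at a point of one copy**: for a function `g_i` vanishing off
`Ūᵢ`, `q ∈ Ū₁ ∪ Ū₂` and the copy `m`,
`Σ_{(i,m')} g_i(q + (0, c m) - (0, c m')) = g_1(q) + g_2(q)` (all other translates miss `Ū₁ ∪ Ū₂`).
[cite: Ozanski2017NSISingular, §6.3 Step 1 (6.22) and Prop. 16 (ii)] -/
theorem sum_levelFun_translate {U : Fin 2 → Set (ℝ × ℝ)} (hK : closure (U 0) ∪ closure (U 1) ⊆ halfPlane)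
    {c : A → ℝ}
    (hdisj : ∀ m m' : A, m ≠ m' →
      Disjoint ((fun y : EuclideanSpace ℝ (Fin 3) => y + c m • eZ) '' revolve (closure (U 0) ∪ closure (U 1)))
        ((fun y : EuclideanSpace ℝ (Fin 3) => y + c m' • eZ) '' revolve (closure (U 0) ∪ closure (U 1))))
    {g : Fin 2 → ℝ × ℝ → ℝ} (hg : ∀ i, ∀ q ∉ closure (U i), g i q = 0) {q : ℝ × ℝ}
    (hq : q ∈ closure (U 0) ∪ closure (U 1)) (m : A) :
    ∑ p : Fin 2 × A, g p.1 (q + (0, c m) + (0, -c p.2)) = g 0 q + g 1 q := by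
  have hmem : ∀ {i : Fin 2} {p : ℝ × ℝ}, p ∈ closure (U i) → p ∈ closure (U 0) ∪ closure (U 1) := by
    intro i p hp
    fin_cases i
    · exact Or.inl hp
    · exact Or.inr hp
  have hoff : ∀ p : Fin 2 × A, p.2 ≠ m → g p.1 (q + (0, c m) + (0, -c p.2)) = 0 := by
    intro p hne
    apply hg
    intro hcl
    have e : q + (0, c m) + (0, -c p.2) = q + (0, c m - c p.2) := by
      ext <;> simp; ring
    rw [e] at hcl
    exact notMem_of_disjoint_translates hK hdisj (Ne.symm hne) hq (hmem hcl)
  have e0 : ∀ i : Fin 2, q + (0, c m) + (0, -c m) = q := fun _ => by ext <;> simp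
  rw [Fintype.sum_prod_type]
  have inner : ∀ i : Fin 2, ∑ m' : A, g i (q + (0, c m) + (0, -c m')) = g i q := fun i => by
    rw [Finset.sum_eq_single m (fun m' _ hne => hoff (i, m') hne) (fun h => (h (Finset.mem_univ m)).elim),
      e0 i]
  simp only [inner, Fin.sum_univ_two]

end Literature.Barriers.NavierStokesRegularity
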